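/-
COR-CM (cell pub-hodgecm2, stage 2 of the Hodge ladder) — junction B01 `PerLFace_of_PerL`: the displayed leaf B01-S `Universe.FaceSupply` in its
HOM-LEVEL normal form through the Albanese — `FaceSupply ↔ ∃ non-zero homs Alb(P_Γ) ⟶ A_{(F,Ψ₀)}, A_{(F,Ψ₁)}` on the model universe of record
(an EQUIVALENT form of B01-S, count-neutral; RULING MVA-PATH (B), lead gen 5, 2026-08-21T08:36Z).  AUTHORED by seat b10 gen 17
(prover-pub-hodgecm2-b10-g17-0; staged `HOME/pub-hodgecm2-b10/gen17/B01FaceSupplyIffAlbaneseHom.lean`, definition-free v3, md5 0774730f02e9; farm rc 0 in b10ʼs concat probe) over its `CorCM/Geometry/ConstantMorphisms.lean` (p257886),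
its `CorCM/Geometry/MorphismsViaAlbanese.lean`, `Literature/AlgebraicGeometry/Motives/AlbaneseExistenceComplex.lean` and own-b01ʼs
`CorCM/B01/FaceSupplyAlbanese.lean` (p255549); FILED verbatim (this header replacing the staging header) by the single owner of B01,
prover-pub-hodgecm2-own-b01-0.  Theorems only; nothing cited as a record, nothing asserted.
-/
import Summits.HodgeConjecture.CorCM.B01.FaceSupplyAlbanese
import Summits.HodgeConjecture.CorCM.Geometry.MorphismsViaAlbanese
import Summits.HodgeConjecture.CorCM.Geometry.ConstantMorphisms
import Literature.AlgebraicGeometry.Motives.AlbaneseExistenceComplex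
import HarnessLib

/-!
# B01-S ⟺ `Hom(Alb(P_Γ), A_{(F,ψ₀)}) ≠ 0 ∧ Hom(Alb(P_Γ), A_{(F,ψ₁)}) ≠ 0` (junction B01, SUPPLY leaf)

ON THE UNIVERSE OF RECORD `picardCMUniverse hHD hI h₁ h₃`.  own-b01's `B01/FaceSupplyAlbanese` (p255549) re-types the
displayed input B01-S `Universe.FaceSupply` at the level of MORPHISMS: `FaceSupply ↔ FaceAlbaneseReach` (morphisms
`P_Γ → A_{(F,ψ₀)}`, `P_Γ → A_{(F,ψ₁)}` non-zero on `H¹(−, ℚ)` at some level), and row D0 `Universe.Uiso_ne_bot_iff`.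
b10's `Geometry/MorphismsViaAlbanese` (over `Motives/AlbaneseHomNonvanishing`) says a variety of the universe admits a
morphism to `A_{(K,Ψ)}` non-zero on `H¹(−, ℚ)` iff its ALBANESE VARIETY admits a non-zero homomorphism to `A_{(K,Ψ)}`.
Composing:

* `picardCMUniverse_faceAlbaneseReach_iff_exists_hom_ne_zero` — `FaceAlbaneseReach U_rec` iff «for every face datum
  `(F, f, ι₁, V)`, at some level `Γ` and for some (equivalently — `Jacobian.uniqueUpToIso` — any) Albanese datum `𝒥` of
  the realised Picard modular surface `P_Γ`, there are non-zero homomorphisms `Alb(P_Γ) → A_{(F,ψ₀)}` and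
  `Alb(P_Γ) → A_{(F,ψ₁)}`» (right-hand side INLINE, no new definition);
* **`picardCMUniverse_faceSupply_iff_exists_hom_ne_zero`** — **B01-S `FaceSupply U_rec` iff the same right-hand side**;
* `picardCMUniverse_Uiso_ne_bot_iff_exists_hom_ne_zero` — row D0 through the Albanese: for `σ ∈ Ψ`,
  `U_Ψ(Γ)_σ ≠ 0 ↔ Hom(Alb(P_Γ), A_{(K,Ψ)}) ≠ 0` (no simplicity hypothesis on `A_{(K,Ψ)}`);
* the PRINT-LANGUAGE forms (via `Geometry/ConstantMorphisms`: a morphism to an abelian variety is non-zero on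
  `H¹(−, ℚ)` iff it is non-constant): `picardCMUniverse_Uiso_ne_bot_iff_exists_mor_ne_const` (`σ ∈ Ψ`:
  `U_Ψ(Γ)_σ ≠ 0` iff `P_Γ` maps NON-CONSTANTLY to `A_{(K,Ψ)}`) and
  **`picardCMUniverse_faceSupply_iff_exists_mor_ne_const`** (B01-S iff for every face datum some `P_Γ` admits
  non-constant morphisms to `A_{(F,ψ₀)}` and to `A_{(F,ψ₁)}`).

So what SUPPLY asks of the X_Γ-side is exactly that the CM abelian varieties `A_{(F,ψ₀)}`, `A_{(F,ψ₁)}` of the two slot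
types MEET the Albanese variety of some `P_Γ` — in print: Murty–Ramakrishnan 1992 («the Albanese of a Picard modular
surface is of CM type», isogeny factors indexed by theta lifts) / [Liu2021] Cor. 4.20 (`A_K ∼ ∏_μ A_μ^{d(μ,K)}`) plus the
non-vanishing `d(μ, K) ≠ 0` at deep level for the characters of types `ψ₀`, `ψ₁` (stage-1 `hΘ` kind).  The X_Γ-geometry
of SUPPLY is discharged in the kernel; what remains is automorphic.
-/

noncomputable section

open CategoryTheory AlgebraicGeometry
open Literature.AlgebraicGeometry.Motives
open Literature.AlgebraicGeometry.HodgeTheory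
open Literature.NumberTheory.Automorphic.PicardCM

namespace Summit.HodgeConjecture.CorCM

namespace Model

variable {hHD : exists_isReal_hodgeModel} {hI : hodgePQ_independent_of_hodgeModel}
  {h₁ : BallQuotientUniformised} {h₃ : CMAbelianVarietyRealised}

/-- **`FaceAlbaneseReach U_rec` iff the slot varieties meet the Albanese**: for every face datum, at some level `Γ` and
for some Albanese datum `𝒥` of `P_Γ`, `Hom(Alb(P_Γ), A_{(F,ψ₀)}) ≠ 0` and `Hom(Alb(P_Γ), A_{(F,ψ₁)}) ≠ 0`.
(⟹: a morphism non-zero on `H¹(−, ℚ)` gives a non-zero homomorphism from the Albanese,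
`Model.picardCMUniverse_exists_hom_ne_zero_of_pull_ne_zero`, an Albanese datum exists by
`nonempty_jacobian_of_isSmoothProjective_complex_of_dim`; ⟸: `f^P ≫ u` is non-zero on `H¹(−, ℚ)`,
`Model.picardCMUniverse_pull_abelJacobi_comp_ne_zero`.) -/
theorem picardCMUniverse_faceAlbaneseReach_iff_exists_hom_ne_zero :
    (picardCMUniverse hHD hI h₁ h₃).FaceAlbaneseReach ↔
      ∀ (F : CMField), IsGalois ℚ F → 6 ≤ Module.finrank ℚ F →
        ∀ (f : Face F) (ι₁ : F →+* ℂ), f.Admissible ι₁ →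
        ∀ V : HermSpace3 F ι₁, ∃ (Γ : Level V)
          (𝒥 : Jacobian (Var.scheme (ballQuotientUniformisedDatum_of h₁) h₃ (.pms (pmsCode F ι₁ V Γ))))
          (u₀ : 𝒥.J ⟶ (cmRealisation h₃ (cmCode F (f.psi 0))).AV)
          (u₁ : 𝒥.J ⟶ (cmRealisation h₃ (cmCode F (f.psi 1))).AV), u₀ ≠ 0 ∧ u₁ ≠ 0 := by
  constructor
  · intro h F hG h6 f ι₁ hι V
    obtain ⟨Γ, F₀, F₁, hF₀, hF₁⟩ := h F hG h6 f ι₁ hι V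
    have hX := Var.isSmoothProjective (ballQuotientUniformisedDatum_of h₁) h₃ (.pms (pmsCode F ι₁ V Γ))
    obtain ⟨𝒥⟩ := nonempty_jacobian_of_isSmoothProjective_complex_of_dim _ hX
    obtain ⟨P⟩ := hX.nonempty_algPoints ℂ
    obtain ⟨u₀, hu₀⟩ :=
      picardCMUniverse_exists_hom_ne_zero_of_pull_ne_zero (.pms (pmsCode F ι₁ V Γ)) F (f.psi 0) 𝒥 P F₀ hF₀
    obtain ⟨u₁, hu₁⟩ :=
      picardCMUniverse_exists_hom_ne_zero_of_pull_ne_zero (.pms (pmsCode F ι₁ V Γ)) F (f.psi 1) 𝒥 P F₁ hF₁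
    exact ⟨Γ, 𝒥, u₀, u₁, hu₀, hu₁⟩
  · intro h F hG h6 f ι₁ hι V
    obtain ⟨Γ, 𝒥, u₀, u₁, hu₀, hu₁⟩ := h F hG h6 f ι₁ hι V
    obtain ⟨P⟩ :=
      (Var.isSmoothProjective (ballQuotientUniformisedDatum_of h₁) h₃ (.pms (pmsCode F ι₁ V Γ))).nonempty_algPoints ℂ
    exact ⟨Γ, _, _, picardCMUniverse_pull_abelJacobi_comp_ne_zero (.pms (pmsCode F ι₁ V Γ)) F (f.psi 0) 𝒥 P u₀ hu₀,
      picardCMUniverse_pull_abelJacobi_comp_ne_zero (.pms (pmsCode F ι₁ V Γ)) F (f.psi 1) 𝒥 P u₁ hu₁⟩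

variable (hHD hI h₁ h₃) in
/-- **B01-S through the Albanese**: `FaceSupply U_rec` iff for every face datum, at some level `Γ`,
`Hom(Alb(P_Γ), A_{(F,ψ₀)}) ≠ 0` and `Hom(Alb(P_Γ), A_{(F,ψ₁)}) ≠ 0` (own-b01's
`picardCMUniverse_faceSupply_iff_albaneseReach` composed with
`picardCMUniverse_faceAlbaneseReach_iff_exists_hom_ne_zero`). -/
theorem picardCMUniverse_faceSupply_iff_exists_hom_ne_zero :
    (picardCMUniverse hHD hI h₁ h₃).FaceSupply ↔
      ∀ (F : CMField), IsGalois ℚ F → 6 ≤ Module.finrank ℚ F →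
        ∀ (f : Face F) (ι₁ : F →+* ℂ), f.Admissible ι₁ →
        ∀ V : HermSpace3 F ι₁, ∃ (Γ : Level V)
          (𝒥 : Jacobian (Var.scheme (ballQuotientUniformisedDatum_of h₁) h₃ (.pms (pmsCode F ι₁ V Γ))))
          (u₀ : 𝒥.J ⟶ (cmRealisation h₃ (cmCode F (f.psi 0))).AV)
          (u₁ : 𝒥.J ⟶ (cmRealisation h₃ (cmCode F (f.psi 1))).AV), u₀ ≠ 0 ∧ u₁ ≠ 0 :=
  (picardCMUniverse_faceSupply_iff_albaneseReach hHD hI h₁ h₃).trans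
    picardCMUniverse_faceAlbaneseReach_iff_exists_hom_ne_zero

/-- **Row D0 through the Albanese**: for `σ ∈ Ψ` and any Albanese datum `𝒥` of `P_Γ`,
`U_Ψ(Γ)_σ ≠ 0 ↔ Hom(Alb(P_Γ), A_{(K,Ψ)}) ≠ 0` (own-b01's `Universe.Uiso_ne_bot_iff` under the rows `Fact_H1_rank`,
`Fact_eigenLine`, `Fact_alphaLine` of `picardCMUniverse_modelAxioms`, composed with
`Model.picardCMUniverse_exists_mor_pull_ne_zero_iff_exists_hom_ne_zero`; no simplicity hypothesis on `A_{(K,Ψ)}`). -/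
theorem picardCMUniverse_Uiso_ne_bot_iff_exists_hom_ne_zero {L : CMField} {ι₁ : L →+* ℂ} {V : HermSpace3 L ι₁}
    (Γ : Level V) (K : CMField) (Ψ : CMType K) {σ : K →+* ℂ} (hσ : σ ∈ Ψ.1)
    (𝒥 : Jacobian (Var.scheme (ballQuotientUniformisedDatum_of h₁) h₃ (.pms (pmsCode L ι₁ V Γ)))) :
    (picardCMUniverse hHD hI h₁ h₃).Uiso Γ K Ψ σ ≠ ⊥ ↔
      ∃ u : 𝒥.J ⟶ (cmRealisation h₃ (cmCode K Ψ)).AV, u ≠ 0 :=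
  (Universe.Uiso_ne_bot_iff (picardCMUniverse_modelAxioms hHD hI h₁ h₃).H1_rank
      (picardCMUniverse_modelAxioms hHD hI h₁ h₃).eigenLine (picardCMUniverse_modelAxioms hHD hI h₁ h₃).alphaLine
      Γ K Ψ hσ).trans
    (picardCMUniverse_exists_mor_pull_ne_zero_iff_exists_hom_ne_zero (.pms (pmsCode L ι₁ V Γ)) K Ψ 𝒥)

/-- **Row D0 in print language**: for `σ ∈ Ψ`, `U_Ψ(Γ)_σ ≠ 0` iff the realised Picard modular surface `P_Γ` admits
a NON-CONSTANT morphism to `A_{(K,Ψ)}` (own-b01's `Universe.Uiso_ne_bot_iff` composed with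
`Model.picardCMUniverse_pull_ne_zero_iff_forall_ne_const` of `Geometry/ConstantMorphisms`). -/
theorem picardCMUniverse_Uiso_ne_bot_iff_exists_mor_ne_const {L : CMField} {ι₁ : L →+* ℂ} {V : HermSpace3 L ι₁}
    (Γ : Level V) (K : CMField) (Ψ : CMType K) {σ : K →+* ℂ} (hσ : σ ∈ Ψ.1) :
    (picardCMUniverse hHD hI h₁ h₃).Uiso Γ K Ψ σ ≠ ⊥ ↔
      ∃ F : (picardCMUniverse hHD hI h₁ h₃).Mor ((picardCMUniverse hHD hI h₁ h₃).pms L ι₁ V Γ)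
          ((picardCMUniverse hHD hI h₁ h₃).cmAV K Ψ),
        ∀ a : (cmRealisation h₃ (cmCode K Ψ)).AV.Points ℂ,
          F ≠ toSpecOver (Var.scheme (ballQuotientUniformisedDatum_of h₁) h₃ (.pms (pmsCode L ι₁ V Γ))) ≫ a := by
  rw [Universe.Uiso_ne_bot_iff (picardCMUniverse_modelAxioms hHD hI h₁ h₃).H1_rank
      (picardCMUniverse_modelAxioms hHD hI h₁ h₃).eigenLine (picardCMUniverse_modelAxioms hHD hI h₁ h₃).alphaLine
      Γ K Ψ hσ]
  exact exists_congr fun F =>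
    picardCMUniverse_pull_ne_zero_iff_forall_ne_const (.pms (pmsCode L ι₁ V Γ)) K Ψ F

variable (hHD hI h₁ h₃) in
/-- **B01-S in print language**: `FaceSupply U_rec` iff for every face datum `(F, f, ι₁, V)`, at some level `Γ`, the
realised Picard modular surface `P_Γ` admits NON-CONSTANT morphisms to `A_{(F,ψ₀)}` and to `A_{(F,ψ₁)}` (own-b01's
`picardCMUniverse_faceSupply_iff_albaneseReach` read through `Model.picardCMUniverse_pull_ne_zero_iff_forall_ne_const`).
This is the shape of the print statements («the CM abelian varieties attached to the theta lifts of the characters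
of types `ψ₀`, `ψ₁` are quotients of `Alb(S_Γ)`», Murty–Ramakrishnan; Dimitrov–Ramakrishnan 2015 Lemma 3.5 /
Prop. 3.6 over Rogawski for the typewise form). -/
theorem picardCMUniverse_faceSupply_iff_exists_mor_ne_const :
    (picardCMUniverse hHD hI h₁ h₃).FaceSupply ↔
      ∀ (F : CMField), IsGalois ℚ F → 6 ≤ Module.finrank ℚ F →
        ∀ (f : Face F) (ι₁ : F →+* ℂ), f.Admissible ι₁ →
        ∀ V : HermSpace3 F ι₁, ∃ (Γ : Level V)
          (F₀ : (picardCMUniverse hHD hI h₁ h₃).Mor ((picardCMUniverse hHD hI h₁ h₃).pms F ι₁ V Γ)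
            ((picardCMUniverse hHD hI h₁ h₃).cmAV F (f.psi 0)))
          (F₁ : (picardCMUniverse hHD hI h₁ h₃).Mor ((picardCMUniverse hHD hI h₁ h₃).pms F ι₁ V Γ)
            ((picardCMUniverse hHD hI h₁ h₃).cmAV F (f.psi 1))),
          (∀ a : (cmRealisation h₃ (cmCode F (f.psi 0))).AV.Points ℂ,
              F₀ ≠ toSpecOver (Var.scheme (ballQuotientUniformisedDatum_of h₁) h₃ (.pms (pmsCode F ι₁ V Γ))) ≫ a) ∧
          (∀ a : (cmRealisation h₃ (cmCode F (f.psi 1))).AV.Points ℂ,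
              F₁ ≠ toSpecOver (Var.scheme (ballQuotientUniformisedDatum_of h₁) h₃ (.pms (pmsCode F ι₁ V Γ))) ≫ a) := by
  rw [picardCMUniverse_faceSupply_iff_albaneseReach hHD hI h₁ h₃]
  refine forall_congr' fun F => forall_congr' fun _ => forall_congr' fun _ => forall_congr' fun f =>
    forall_congr' fun ι₁ => forall_congr' fun _ => forall_congr' fun V => exists_congr fun Γ =>
    exists_congr fun F₀ => exists_congr fun F₁ => ?_
  exact and_congr (picardCMUniverse_pull_ne_zero_iff_forall_ne_const (.pms (pmsCode F ι₁ V Γ)) F (f.psi 0) F₀)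
    (picardCMUniverse_pull_ne_zero_iff_forall_ne_const (.pms (pmsCode F ι₁ V Γ)) F (f.psi 1) F₁)

end Model

end Summit.HodgeConjecture.CorCM

end
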